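import Mathlib
import Summits.Ventures.DiscreteObjects.Mahler.CensusKernelDeg20P001
import Summits.Ventures.DiscreteObjects.Mahler.CensusKernelDeg20P002
import Summits.Ventures.DiscreteObjects.Mahler.CensusKernelDeg20P003
import Summits.Ventures.DiscreteObjects.Mahler.CensusKernelDeg20P004
import Summits.Ventures.DiscreteObjects.Mahler.CensusKernelDeg20P005
import Summits.Ventures.DiscreteObjects.Mahler.CensusKernelDeg20P006
import Summits.Ventures.DiscreteObjects.Mahler.CensusKernelDeg20P007
import Summits.Ventures.DiscreteObjects.Mahler.CensusKernelDeg20P008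
import Summits.Ventures.DiscreteObjects.Mahler.CensusKernelDeg20P009
import Summits.Ventures.DiscreteObjects.Mahler.CensusKernelDeg20P010
import Summits.Ventures.DiscreteObjects.Mahler.CensusKernelDeg20P011
import Summits.Ventures.DiscreteObjects.Mahler.CensusKernelDeg20P012
import Summits.Ventures.DiscreteObjects.Mahler.CensusKernelDeg20P013
import Summits.Ventures.DiscreteObjects.Mahler.CensusKernelDeg20P014
import Summits.Ventures.DiscreteObjects.Mahler.CensusKernelDeg20P015
import Summits.Ventures.DiscreteObjects.Mahler.CensusKernelDeg20P016
import Summits.Ventures.DiscreteObjects.Mahler.CensusKernelDeg20P017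
import Summits.Ventures.DiscreteObjects.Mahler.CensusKernelDeg20P018
import Summits.Ventures.DiscreteObjects.Mahler.CensusKernelDeg20P019
import Summits.Ventures.DiscreteObjects.Mahler.CensusKernelDeg20P020
import Summits.Ventures.DiscreteObjects.Mahler.CensusKernelDeg20P021
import Summits.Ventures.DiscreteObjects.Mahler.CensusKernelDeg20P022
import Summits.Ventures.DiscreteObjects.Mahler.CensusKernelDeg20P023
import Summits.Ventures.DiscreteObjects.Mahler.CensusKernelDeg20P024
import Summits.Ventures.DiscreteObjects.Mahler.CensusKernelDeg20P025
import Summits.Ventures.DiscreteObjects.Mahler.CensusKernelDeg20P026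
import Summits.Ventures.DiscreteObjects.Mahler.CensusKernelDeg20P027
import Summits.Ventures.DiscreteObjects.Mahler.CensusKernelDeg20P028
import Summits.Ventures.DiscreteObjects.Mahler.CensusKernelDeg20P029
import Summits.Ventures.DiscreteObjects.Mahler.CensusKernelDeg20P030
import Summits.Ventures.DiscreteObjects.Mahler.CensusKernelDeg20P031
import Summits.Ventures.DiscreteObjects.Mahler.CensusKernelDeg20P032
import Summits.Ventures.DiscreteObjects.Mahler.CensusKernelDeg20P033
import Summits.Ventures.DiscreteObjects.Mahler.CensusKernelDeg20P034
import Summits.Ventures.DiscreteObjects.Mahler.CensusKernelDeg20P035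
import Summits.Ventures.DiscreteObjects.Mahler.CensusKernelDeg20P036
import Summits.Ventures.DiscreteObjects.Mahler.CensusKernelDeg20P037
import Summits.Ventures.DiscreteObjects.Mahler.CensusKernelDeg20P038
import Summits.Ventures.DiscreteObjects.Mahler.CensusKernelDeg20P039
import Summits.Ventures.DiscreteObjects.Mahler.CensusKernelDeg20P040
import Summits.Ventures.DiscreteObjects.Mahler.CensusKernelDeg20P041
import Summits.Ventures.DiscreteObjects.Mahler.CensusKernelDeg20P042
import Summits.Ventures.DiscreteObjects.Mahler.CensusKernelDeg20P043
import Summits.Ventures.DiscreteObjects.Mahler.CensusKernelDeg20P044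
import Summits.Ventures.DiscreteObjects.Mahler.CensusKernelDeg20P045
import Summits.Ventures.DiscreteObjects.Mahler.CensusKernelDeg20P046
import Summits.Ventures.DiscreteObjects.Mahler.CensusKernelDeg20P047
import Summits.Ventures.DiscreteObjects.Mahler.CensusKernelDeg20P048
import Summits.Ventures.DiscreteObjects.Mahler.CensusKernelDeg20P049
import Summits.Ventures.DiscreteObjects.Mahler.CensusKernelDeg20P050
import Summits.Ventures.DiscreteObjects.Mahler.CensusKernelDeg20P051
import Summits.Ventures.DiscreteObjects.Mahler.CensusKernelDeg20P052
import Summits.Ventures.DiscreteObjects.Mahler.CensusKernelDeg20P053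
import Summits.Ventures.DiscreteObjects.Mahler.CensusKernelDeg20P054
import Summits.Ventures.DiscreteObjects.Mahler.CensusKernelDeg20P055
import Summits.Ventures.DiscreteObjects.Mahler.CensusKernelDeg20P056
import Summits.Ventures.DiscreteObjects.Mahler.CensusKernelDeg20P057
import Summits.Ventures.DiscreteObjects.Mahler.CensusKernelDeg20P058
import Summits.Ventures.DiscreteObjects.Mahler.CensusKernelDeg20P059
import Summits.Ventures.DiscreteObjects.Mahler.CensusKernelDeg20P060
import Summits.Ventures.DiscreteObjects.Mahler.CensusKernelDeg20P061
import Summits.Ventures.DiscreteObjects.Mahler.CensusKernelDeg20P062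
import Summits.Ventures.DiscreteObjects.Mahler.CensusKernelDeg20P063
import Summits.Ventures.DiscreteObjects.Mahler.CensusKernelDeg20P064
import Summits.Ventures.DiscreteObjects.Mahler.CensusKernelDeg20P065
import Summits.Ventures.DiscreteObjects.Mahler.CensusKernelDeg20P066
import Summits.Ventures.DiscreteObjects.Mahler.CensusKernelDeg20P067
import Summits.Ventures.DiscreteObjects.Mahler.CensusKernelDeg20P068
import Summits.Ventures.DiscreteObjects.Mahler.CensusKernelDeg20P069
import Summits.Ventures.DiscreteObjects.Mahler.CensusKernelDeg20P070
import Summits.Ventures.DiscreteObjects.Mahler.CensusKernelDeg20P071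
import Summits.Ventures.DiscreteObjects.Mahler.CensusKernelDeg20P072
import Summits.Ventures.DiscreteObjects.Mahler.CensusKernelDeg20P073
import Summits.Ventures.DiscreteObjects.Mahler.CensusKernelDeg20P074
import Summits.Ventures.DiscreteObjects.Mahler.CensusKernelDeg20P075
import Summits.Ventures.DiscreteObjects.Mahler.CensusKernelDeg20P076
import Summits.Ventures.DiscreteObjects.Mahler.CensusKernelDeg20P077
import Summits.Ventures.DiscreteObjects.Mahler.CensusKernelDeg20P078
import Summits.Ventures.DiscreteObjects.Mahler.CensusKernelDeg20P079
import Summits.Ventures.DiscreteObjects.Mahler.CensusKernelDeg20P080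
import Summits.Ventures.DiscreteObjects.Mahler.CensusKernelDeg20P081
import Summits.Ventures.DiscreteObjects.Mahler.CensusKernelDeg20P082
import Summits.Ventures.DiscreteObjects.Mahler.CensusKernelDeg20P083
import Summits.Ventures.DiscreteObjects.Mahler.CensusKernelDeg20P084
import Summits.Ventures.DiscreteObjects.Mahler.CensusKernelDeg20P085
import Summits.Ventures.DiscreteObjects.Mahler.CensusKernelDeg20P086
import Summits.Ventures.DiscreteObjects.Mahler.CensusKernelDeg20P087
import Summits.Ventures.DiscreteObjects.Mahler.CensusKernelDeg20P088
import Summits.Ventures.DiscreteObjects.Mahler.CensusKernelDeg20P089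
import Summits.Ventures.DiscreteObjects.Mahler.CensusKernelDeg20P090
import Summits.Ventures.DiscreteObjects.Mahler.CensusKernelDeg20P091
import Summits.Ventures.DiscreteObjects.Mahler.CensusKernelDeg20P092
import Summits.Ventures.DiscreteObjects.Mahler.CensusKernelDeg20P093
import Summits.Ventures.DiscreteObjects.Mahler.CensusKernelDeg20P094
import Summits.Ventures.DiscreteObjects.Mahler.CensusKernelDeg20P095
import Summits.Ventures.DiscreteObjects.Mahler.CensusKernelDeg20P096
import Summits.Ventures.DiscreteObjects.Mahler.CensusKernelDeg20P097
import Summits.Ventures.DiscreteObjects.Mahler.CensusKernelDeg20P098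
import Summits.Ventures.DiscreteObjects.Mahler.CensusKernelDeg20P099
import Summits.Ventures.DiscreteObjects.Mahler.CensusKernelDeg20P100

/-!
# Kernel census, degree 20 (part C1): collector 1: imports chunk parts P001…P100

Cell `pub-namedobj`, seat `pub-namedobj-mahler-g16`. Framing: lottery ticket; floor = certified bounds/negative ranges.

Part of the kernel proof of `DegreeCensus 20 (13/10) coresDeg20` (see part A for the method: census search with
Toeplitz/resultant cuts, kernel-certified explicit-auxiliary-function cuts and certified leaf thresholds; 823081 leaves
with `c_1 >= 0`, 143927 survivors certified by extended certificates `CertX`: base red/cyc/exc or trace-Graeffe `tgr`).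
This part holds, for the search nodes listed below, one kernel check each (`decide` with kernel reduction, standard axioms;
nodes costing more than the per-theorem budget are split by the next coefficient and re-assembled by a node lemma).
CONTROL/replication of the published degree-20 list (Boyd 1980/1989; Mossinghoff 1998; Mossinghoff-Rhin-Wu 2008), not new ground.
-/

namespace Summit.Ventures.DiscreteObjects.Mahler

open Polynomial

/-- Collector 1 of the degree-20 kernel census imports chunk parts `P001` … `P100`; as its own (small) fact it records
that the threshold list `T20` has 40 entries (k = 1..4d). -/
theorem T20_length : T20.length = 40 := by decide

end Summit.Ventures.DiscreteObjects.Mahler
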